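import Summits.QuantumFields.YangMills.Theorems.BalabanUVNodesN15NeumannCubePropagator
import Summits.QuantumFields.YangMills.Theorems.BalabanUVNodesN15TwoGridLocality
import Summits.QuantumFields.YangMills.Theorems.BalabanUVNodesN15TwoGridAveraging
import HarnessLib

/-!
# Route «BalabanUVNodes» (K3⁷), node N15 = NE2, -a lane, PROGRAMME N file N-IIIb: THE GLUING LETTER OF THE NEUMANN CUBE PROPAGATOR — «MIRROR IMAGES ARE FARTHER» AND THE
# BLOCK MAJORANT `χ_□ ∘ G(□) ≤ 1_□(y)·1_□(y′)·β·e^{−δ|y−y′|_T}` AT `U ≡ 1`, UNIFORM OVER THE TORUS FAMILY AND THE CUBE POSITION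

Cell `pub-ymgap`, seat `pub-ymgap-dag-n15-a` (KNIT-BY-NAME, g19; D-0062; chair R424 venue; `bears_on: R4∕N15`); `--kind proof --supports stmt-QuantumFields-20544 --as helper`.
Sequel of N-IIIa `…N15NeumannCubePropagator` (`neumannCubeG M n c S a := Sym_c ∘ G ∘ χ°_c`, per-cube locality).  CONSUMER: dag-n15-c's `…N15TwoSpacingGluingCubes` ★ `hasMaj_parametrix` ∕
`hasMaj_glued_of_cubes` — hypothesis `hG : HasMaj … (G i) (fun y y' => ind (S i) y * ind (S i) y' * (β * exp (−δ·dist)))`; here `G i := χ_□ ∘ G(□ + c)` and `S i :=` the cube's blocks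
(`M_h G(□) M_h = M_h (χ_□ G(□)) M_h` for partitions supported in the cube, so the parametrix is unchanged; `hloc` is N-IIIa's, for the uncompressed `G(□)`).

WHAT.  §9: `reflBlk` (images of BLOCKS), `cubeBlocks M c S` (`Finset`), `chiCube`; `blockOf_add_up`, `blockOf_torRefl`, ★ `blockOf_imgPt`, `blockOf_mem_cubeBlocks`.  §9b ★★ «MIRROR IMAGES ARE
FARTHER»: `circAbs_mirror_ge` (in `ℤ∕2S`: for `0 ≤ u, u′ < S`, `circAbs(−1−u−u′) ≥ circAbs(u−u′)`), `circAbs_coord_mirror_ge`, ★★ `tdistT_le_tdistT_reflBlk`, ★★ `tdistT_blockOf_imgBond_ge` (the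
bond twist costs at most one block).  §10 ★ `hasMaj_comp_mulOp_chiInt`, ★★ `hasMaj_chiCube_reflSet_comp`, `hasMaj_chiCube_symOp_comp` (`2^{d+1}` images), ★★★ **`hasMaj_chiCube_neumannCubeG`**:
for odd `L > 1`, `a > 0` there are `δ, β > 0` with, for EVERY `m, K ≥ 1` and cube position `c`, `HasMaj (ofBlocks g blkFine) (ofBlocks g blkFine) (mulOp χ_□ ∘ₗ neumannCubeG (MP …) (L^K) c (L^m) a)
(fun y y' => ind □ y * ind □ y' * (β * exp (−δ·|y−y′|_T)))` — the (2.133)-shaped gluing letter from (1.110) (`hasMaj_gOp`) by the method of images, `β = 2^{d+1}·C·e^{δ₀}`.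
HONEST FRAMING.  Finite lattice geometry + block-majorant bookkeeping over the landed (1.110) torus letter; no new analytic estimate; `U ≡ 1` torus MODEL of [B5] §1 on the doubled-cube
family `M_ν = 2L^m`; Neumann-by-images = print's (2.37) «e.g.» choice, not the multiscale `G(Ω)` of record; entry 1 (`∇G(□)`) and the two-grid defects of the cube propagators (`hDG`,
with the CENTRE-anchored pairing) are the sequels; nothing of [B6] (2.38)–(2.40) asserted; N15 NOT discharged (object-bound; NE2⁺ NOT PRINTED); counts UNMOVED (typed 28∕28 · discharged
5∕27); one finite torus — NOT continuum ∕ ℝ⁴ ∕ OS ∕ mass gap ∕ Clay.  Plumbing defs are DATA (`reflBlk`, `cubeBlocks`, `chiCube`); every theorem is [folklore] lattice algebra ∕ bookkeeping.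
-/

noncomputable section

open scoped BigOperators Matrix
open Finset

namespace Summit.QuantumFields.YangMills.BalabanUVNodes.N15.TwoGrid

open Literature.MathematicalPhysics.QuantumFieldTheory.Balaban1983to89
open Literature.MathematicalPhysics.QuantumFieldTheory.Balaban1983to89.B5Prop11Plancherel (Tor fine unitVec)
open Literature.MathematicalPhysics.QuantumFieldTheory.Balaban1983to89.B5Block118 (up bpt)
open Literature.MathematicalPhysics.QuantumFieldTheory.Balaban1983to89.B6Prop26Gluing (mulOp mulOp_apply ind ind_nonneg ind_le_one)
open Literature.MathematicalPhysics.QuantumFieldTheory.King1986.Torus (blockOf tdistT toSite tdistT_triangle tdistT_symm tdistT_nonneg)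
open Literature.MathematicalPhysics.QuantumFieldTheory.Balaban1983to89.B11SectG (BlockNorm HasMaj)
open Literature.MathematicalPhysics.QuantumFieldTheory.Balaban1983to89.B6UnitTorusCarrier (unitTorusGeo)
open Literature.MathematicalPhysics.QuantumFieldTheory.Balaban1983to89.B4Sect5Torus (ccoord tdist)
open Literature.MathematicalPhysics.QuantumFieldTheory.Balaban1983to89.B5SiteBridgeP12 (MP)
open Summit.QuantumFields.YangMills.BalabanUVNodes.N15.VectorPiece (blkFine tdistT_blockOf_sub_unitVec_le)

variable {d : ℕ}

/-! ## §9 Mirror geometry on the unit lattice: images of blocks, the cube's blocks, «mirror images are farther» -/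

section BlockImages

variable (M : Fin (d + 1) → ℕ) [∀ μ, NeZero (M μ)] (n : ℕ) [NeZero n] (c : Tor M)

/-- the image of a BLOCK under the reflections in the lower faces of `□ + c` in the directions of `T`: `y_ν ↦ 2c_ν − 1 − y_ν`. [folklore] -/
def reflBlk (T : Finset (Fin (d + 1))) (y : Tor M) : Tor M := fun ν => if ν ∈ T then 2 * c ν - 1 - y ν else y ν

/-- THE BLOCKS OF THE CUBE `□ + c` of side `S` (a `Finset` of unit-lattice sites): `0 ≤ y_ν − c_ν < S` in every direction. [cite: Balaban1984PropagatorsII, p.229 («each cube being a sum of … big blocks»)] -/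
def cubeBlocks (S : ℕ) : Finset (Tor M) := Finset.univ.filter fun y => ∀ ν, (y ν - c ν).val < S

/-- the indicator of the cube's blocks, read on fine bonds. [folklore] -/
def chiCube (S : ℕ) (b : Tor (fine n M) × Fin (d + 1)) : ℝ := if blockOf n M b.1 ∈ cubeBlocks M c S then 1 else 0

variable {M n c}

omit [NeZero n] in
/-- membership in the cube's blocks, unfolded. [folklore] -/
theorem mem_cubeBlocks {S : ℕ} (y : Tor M) : y ∈ cubeBlocks M c S ↔ ∀ ν, (y ν - c ν).val < S := by
  simp [cubeBlocks]

/-- `|χ_□| ≤ 1`. [folklore] -/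
theorem abs_chiCube_le_one (S : ℕ) (b : Tor (fine n M) × Fin (d + 1)) : |chiCube M n c S b| ≤ 1 := by
  unfold chiCube; split_ifs <;> simp

/-- `χ_□ = 0` off the cube's blocks. [folklore] -/
theorem chiCube_of_not_mem {S : ℕ} {b : Tor (fine n M) × Fin (d + 1)} (h : blockOf n M b.1 ∉ cubeBlocks M c S) : chiCube M n c S b = 0 := by
  unfold chiCube; rw [if_neg h]

/-- block translations move blocks: `B(x + n·c) = B(x) + c`. [folklore] -/
theorem blockOf_add_up (x : Tor (fine n M)) (cv : Tor M) : blockOf n M (x + up n M cv) = blockOf n M x + cv := by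
  obtain ⟨a, hx⟩ := exists_eq_bpt_blockOf M n x
  have h : x + up n M cv = bpt n M (blockOf n M x + cv) a := by rw [bpt_add, ← hx]
  rw [h, DefectKernel.kingBlockOf_bpt]

/-- `B(x − n·c) = B(x) − c`. [folklore] -/
theorem blockOf_sub_up (x : Tor (fine n M)) (cv : Tor M) : blockOf n M (x - up n M cv) = blockOf n M x - cv := by
  have up_neg : up n M (-cv) = -up n M cv := by funext ν; simp [up]
  rw [sub_eq_add_neg, ← up_neg, blockOf_add_up, ← sub_eq_add_neg]

/-- reflections move blocks: `B(σx) = σ̃B(x)`. [folklore] -/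
theorem blockOf_torRefl (κ : Fin (d + 1)) (x : Tor (fine n M)) : blockOf n M (torRefl (fine n M) κ x) = torRefl M κ (blockOf n M x) := by
  obtain ⟨a, hx⟩ := exists_eq_bpt_blockOf M n x
  have h : torRefl (fine n M) κ x = bpt n M (torRefl M κ (blockOf n M x)) (flipIdx n κ a) := by rw [← torRefl_bpt, ← hx]
  rw [h, DefectKernel.kingBlockOf_bpt]

omit [∀ μ, NeZero (M μ)] [NeZero n] in
/-- the one-face image on points, as a conjugated reflection: `img_{{κ}} x = σ_κ(x − n·c) + n·c`. [folklore] -/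
theorem imgPt_singleton_eq (κ : Fin (d + 1)) (x : Tor (fine n M)) : imgPt M n c {κ} x = torRefl (fine n M) κ (x - up n M c) + up n M c := by
  funext ν; by_cases h : ν = κ
  · subst h; simp only [imgPt, Finset.mem_singleton, if_true, Pi.add_apply, torRefl_apply_same, Pi.sub_apply]; ring
  · simp [imgPt, h]

omit [NeZero n] [∀ μ, NeZero (M μ)] in
/-- the same on blocks: `reflBlk_{{κ}} y = σ̃_κ(y − c) + c`. [folklore] -/
theorem reflBlk_singleton_eq (κ : Fin (d + 1)) (y : Tor M) : reflBlk M c {κ} y = torRefl M κ (y - c) + c := by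
  funext ν; by_cases h : ν = κ
  · subst h; simp only [reflBlk, Finset.mem_singleton, if_true, Pi.add_apply, torRefl_apply_same, Pi.sub_apply]; ring
  · simp [reflBlk, h]

omit [NeZero n] [∀ μ, NeZero (M μ)] in
/-- composing block images. [folklore] -/
theorem reflBlk_reflBlk (κ : Fin (d + 1)) {T : Finset (Fin (d + 1))} (hκ : κ ∉ T) (y : Tor M) :
    reflBlk M c T (reflBlk M c {κ} y) = reflBlk M c (insert κ T) y := by
  funext ν
  by_cases h1 : ν = κ
  · subst h1; simp [reflBlk, hκ]
  · by_cases h2 : ν ∈ T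
    · simp [reflBlk, h1, h2]
    · simp [reflBlk, h1, h2]

omit [NeZero n] [∀ μ, NeZero (M μ)] in
/-- `reflBlk_∅ = id`. [folklore] -/
theorem reflBlk_empty (y : Tor M) : reflBlk M c ∅ y = y := by
  funext ν; simp [reflBlk]

/-- ★ **BLOCKS OF IMAGES ARE IMAGES OF BLOCKS**: `B(img_T x) = reflBlk_T B(x)`. [folklore] -/
theorem blockOf_imgPt (T : Finset (Fin (d + 1))) (x : Tor (fine n M)) : blockOf n M (imgPt M n c T x) = reflBlk M c T (blockOf n M x) := by
  induction T using Finset.induction_on generalizing x with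
  | empty => rw [imgPt_empty, reflBlk_empty]
  | @insert κ T hκ ih =>
      rw [← imgPt_imgPt κ hκ, ih, imgPt_singleton_eq, blockOf_add_up, blockOf_torRefl, blockOf_sub_up, ← reflBlk_singleton_eq, reflBlk_reflBlk κ hκ]

/-- the block of an interior bond of the cube is a block of the cube (`Sn`-window on fine coordinates ⟹ `S`-window on blocks). [folklore] -/
theorem blockOf_mem_cubeBlocks {S : ℕ} {b : Tor (fine n M) × Fin (d + 1)} (hb : b ∈ intBonds M n c S) : blockOf n M b.1 ∈ cubeBlocks M c S := by
  rw [mem_cubeBlocks]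
  intro ν
  have h := ((mem_intBonds b).mp hb).1 ν
  obtain ⟨a, hx⟩ := exists_eq_bpt_blockOf M n b.1
  have hsub : b.1 - up n M c = bpt n M (blockOf n M b.1 - c) a := by
    have up_neg : up n M (-c) = -up n M c := by funext ν; simp [up]
    rw [sub_eq_add_neg, ← up_neg, sub_eq_add_neg, bpt_add, ← hx]
  have hval : (b.1 ν - up n M c ν) = (b.1 - up n M c) ν := rfl
  rw [hval, hsub, B5Blocks16.bpt_val] at h
  by_contra hge
  rw [not_lt] at hge
  have : S * n ≤ n * ((blockOf n M b.1 - c) ν).val := by rw [mul_comm]; exact Nat.mul_le_mul_left n hge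
  omega

end BlockImages

/-! ## §9b «Mirror images are farther»: `|reflBlk_T y − y′|_T ≥ |y − y′|_T` for blocks `y, y′` of the cube (torus = doubled cube) -/

section Mirror

open Literature.MathematicalPhysics.QuantumFieldTheory.Balaban1983to89.B4TorusKernel
open Literature.MathematicalPhysics.QuantumFieldTheory.Balaban1983to89.B4TorusKernel.MultiPeriod
open Literature.MathematicalPhysics.QuantumFieldTheory.Balaban1983to89.B4Sect5Torus

/-- the integer heart: for `0 ≤ u, u′ < S` and `N = 2S`, the circular distance in `ℤ∕N` of `−1 − u − u′` (mirror image vs original) dominates that of `u − u′`. [folklore] -/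
theorem circAbs_mirror_ge {S N : ℕ} (hN : N = 2 * S) {u u' : ℤ} (hu : 0 ≤ u) (hu' : 0 ≤ u') (huS : u < S) (hu'S : u' < S) :
    circAbs N (u - u') ≤ circAbs N (-1 - u - u') := by
  subst hN
  have hS : 1 ≤ 2 * S := by omega
  have habs : |u - u'| < (S : ℤ) := abs_sub_lt_iff.mpr ⟨by linarith, by linarith⟩
  have h0 : circAbs (2 * S) (u - u') = |u - u'| := circAbs_of_centred hS (by push_cast; linarith)
  rw [h0]
  by_cases hU : u + u' + 1 ≤ S
  · have h1 : circAbs (2 * S) (-1 - u - u') = |1 + u + u'| := by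
      rw [show (-1 - u - u' : ℤ) = -(1 + u + u') by ring, circAbs_neg hS]
      exact circAbs_of_centred hS (by rw [abs_of_nonneg (by linarith)]; push_cast; linarith)
    rw [h1, abs_of_nonneg (by linarith : (0 : ℤ) ≤ 1 + u + u')]
    cases abs_cases (u - u') <;> linarith
  · rw [not_le] at hU
    have h1 : circAbs (2 * S) (-1 - u - u') = |2 * S - 1 - u - u'| := by
      rw [show (-1 - u - u' : ℤ) = (2 * S - 1 - u - u') + ((2 * S : ℕ) : ℤ) * (-1 : ℤ) by push_cast; ring, circAbs_add_mul]
      exact circAbs_of_centred hS (by rw [abs_of_nonneg (by linarith)]; push_cast; linarith)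
    rw [h1, abs_of_nonneg (by linarith : (0 : ℤ) ≤ 2 * S - 1 - u - u')]
    cases abs_cases (u - u') <;> linarith

variable {M : Fin (d + 1) → ℕ} [∀ μ, NeZero (M μ)] {c : Tor M}

/-- the value of a difference in `ℤ∕N` as an integer: `val(a − b) = val a − val b + N·k`. [folklore] -/
theorem exists_val_sub_eq {N : ℕ} [NeZero N] (a b : ZMod N) : ∃ k : ℤ, ((a - b).val : ℤ) = (a.val : ℤ) - b.val + N * k := by
  have h : ((a - b).val + b.val) % N = a.val := by
    rw [← ZMod.val_add, sub_add_cancel]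
  have h2 := Nat.div_add_mod ((a - b).val + b.val) N
  refine ⟨((((a - b).val + b.val) / N : ℕ) : ℤ), ?_⟩
  have h3 : (((a - b).val + b.val : ℕ) : ℤ) = (N : ℤ) * ((((a - b).val + b.val) / N : ℕ) : ℤ) + (a.val : ℤ) := by
    rw [← h]; exact_mod_cast h2.symm
  push_cast at h3 ⊢
  linarith

/-- the value of the reflected block coordinate: `val(2c − 1 − y) = 2·val c − 1 − val y + N·k`. [folklore] -/
theorem exists_val_reflected_eq {N : ℕ} [NeZero N] (cc yy : ZMod N) : ∃ k : ℤ, ((2 * cc - 1 - yy).val : ℤ) = 2 * (cc.val : ℤ) - 1 - yy.val + N * k := by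
  have hcast : (2 * cc - 1 - yy : ZMod N) = (((2 * (cc.val : ℤ) - 1 - yy.val : ℤ)) : ZMod N) := by
    push_cast; rw [ZMod.natCast_zmod_val, ZMod.natCast_zmod_val]
  rw [hcast, ZMod.val_intCast]
  refine ⟨-((2 * (cc.val : ℤ) - 1 - yy.val) / N), ?_⟩
  have := Int.emod_add_mul_ediv (2 * (cc.val : ℤ) - 1 - yy.val) N
  linarith

/-- per-coordinate mirror inequality for the cube's blocks (torus period `2S`). [folklore] -/
theorem circAbs_coord_mirror_ge {S : ℕ} (hM : ∀ ν, M ν = 2 * S) {y y' : Tor M} (hy : y ∈ cubeBlocks M c S) (hy' : y' ∈ cubeBlocks M c S)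
    {T : Finset (Fin (d + 1))} {ν : Fin (d + 1)} (hν : ν ∈ T) :
    circAbs (M ν) (((y ν).val : ℤ) - (y' ν).val) ≤ circAbs (M ν) (((reflBlk M c T y ν).val : ℤ) - (y' ν).val) := by
  rw [mem_cubeBlocks] at hy hy'
  have hu := hy ν
  have hu' := hy' ν
  obtain ⟨k₁, hk₁⟩ := exists_val_sub_eq (y ν) (c ν)
  obtain ⟨k₂, hk₂⟩ := exists_val_sub_eq (y' ν) (c ν)
  have hrefl : reflBlk M c T y ν = 2 * c ν - 1 - y ν := by simp [reflBlk, hν]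
  obtain ⟨k₃, hk₃⟩ := exists_val_reflected_eq (c ν) (y ν)
  rw [hrefl]
  have e1 : ((y ν).val : ℤ) - (y' ν).val = (((y ν - c ν).val : ℤ) - (y' ν - c ν).val) + ((M ν : ℕ) : ℤ) * (k₂ - k₁) := by
    rw [hk₁, hk₂]; ring
  have e2 : (((2 * c ν - 1 - y ν).val : ℤ)) - (y' ν).val = (-1 - ((y ν - c ν).val : ℤ) - (y' ν - c ν).val) + ((M ν : ℕ) : ℤ) * (k₃ + k₁ + k₂) := by
    rw [hk₃, hk₁, hk₂]; ring
  rw [e1, e2, circAbs_add_mul, circAbs_add_mul]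
  exact circAbs_mirror_ge (hM ν) (by positivity) (by positivity) (by exact_mod_cast hu) (by exact_mod_cast hu')

omit [∀ μ, NeZero (M μ)] in
/-- unreflected coordinates are unchanged. [folklore] -/
theorem reflBlk_apply_of_not_mem {T : Finset (Fin (d + 1))} {ν : Fin (d + 1)} (hν : ν ∉ T) (y : Tor M) : reflBlk M c T y ν = y ν := by
  simp [reflBlk, hν]

/-- King's coordinate distance, unfolded on `ZMod` coordinates. [folklore] -/
theorem ccoord_toSite (y z : Tor M) (ν : Fin (d + 1)) : ccoord M (toSite M y) (toSite M z) ν = (circAbs (M ν) (((y ν).val : ℤ) - (z ν).val)).toNat := rfl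

/-- `tdistT` is monotone in the coordinate circular distances. [folklore] -/
theorem tdistT_le_of_coord_le {y₁ y₂ z : Tor M} (h : ∀ ν, circAbs (M ν) (((y₁ ν).val : ℤ) - (z ν).val) ≤ circAbs (M ν) (((y₂ ν).val : ℤ) - (z ν).val)) :
    tdistT M y₁ z ≤ tdistT M y₂ z := by
  unfold tdistT tdist
  have hs : Finset.univ.sup (ccoord M (toSite M y₁) (toSite M z)) ≤ Finset.univ.sup (ccoord M (toSite M y₂) (toSite M z)) :=
    Finset.sup_mono_fun fun ν _ => by rw [ccoord_toSite, ccoord_toSite]; exact Int.toNat_le_toNat (h ν)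
  exact_mod_cast hs

/-- ★★ **MIRROR IMAGES ARE FARTHER**: for blocks `y, y′` of the cube `□ + c` on the doubled torus (`M_ν = 2S`), `|y − y′|_T ≤ |reflBlk_T y − y′|_T`. [cite: Balaban1984PropagatorsII, (2.37) p.229 (method of images)] -/
theorem tdistT_le_tdistT_reflBlk {S : ℕ} (hM : ∀ ν, M ν = 2 * S) {y y' : Tor M} (hy : y ∈ cubeBlocks M c S) (hy' : y' ∈ cubeBlocks M c S) (T : Finset (Fin (d + 1))) :
    tdistT M y y' ≤ tdistT M (reflBlk M c T y) y' := by
  refine tdistT_le_of_coord_le fun ν => ?_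
  by_cases hν : ν ∈ T
  · exact circAbs_coord_mirror_ge hM hy hy' hν
  · rw [reflBlk_apply_of_not_mem hν]

variable {n : ℕ} [NeZero n]

/-- ★★ **THE IMAGE BOND IS (ALMOST) FARTHER**: for an interior... for a bond `b` whose block and `y′` are blocks of the cube, `|B(img_T b) − y′|_T ≥ |B(b) − y′|_T − 1` (the bond twist may move the
image into the neighbouring block). [cite: Balaban1984PropagatorsII, (2.37) p.229 (method of images)] -/
theorem tdistT_blockOf_imgBond_ge {S : ℕ} (hM : ∀ ν, M ν = 2 * S) (T : Finset (Fin (d + 1))) {b : Tor (fine n M) × Fin (d + 1)} {y' : Tor M}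
    (hb : blockOf n M b.1 ∈ cubeBlocks M c S) (hy' : y' ∈ cubeBlocks M c S) :
    tdistT M (blockOf n M b.1) y' - 1 ≤ tdistT M (blockOf n M (imgBond M n c T b).1) y' := by
  have h1 := tdistT_le_tdistT_reflBlk hM hb hy' T
  rw [← blockOf_imgPt T b.1] at h1
  simp only [imgBond]
  split_ifs with hμ
  · have h2 := tdistT_blockOf_sub_unitVec_le n M (imgPt M n c T b.1) b.2
    have h3 := tdistT_triangle M (blockOf n M (imgPt M n c T b.1)) (blockOf n M (imgPt M n c T b.1 - unitVec (fine n M) b.2)) y'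
    rw [tdistT_symm] at h2
    linarith
  · rw [sub_zero]; linarith [h1]

end Mirror

/-! ## §10 The gluing letter: the block majorant of `χ_□ ∘ G(□)`, localized to the cube on both sides -/

section Majorant

open Literature.MathematicalPhysics.QuantumFieldTheory.Balaban1983to89.B11AxialTransport190 (abs_le_loc_ofBlocks loc_ofBlocks_le)

variable {L : ℕ} {M : Fin (d + 1) → ℕ} [∀ μ, NeZero (M μ)] {k n : ℕ} [NeZero n] {c : Tor M} {S : ℕ}

/-- ★ SOURCE LOCALIZATION: an operator with a plain block majorant, fed through `χ°`, has the majorant localized at the cube's blocks. [folklore] -/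
theorem hasMaj_comp_mulOp_chiInt {T : (Tor (fine n M) × Fin (d + 1) → ℝ) →ₗ[ℝ] (Tor (fine n M) × Fin (d + 1) → ℝ)} {C δ : ℝ} (hC : 0 ≤ C)
    (hT : HasMaj (BlockNorm.ofBlocks (unitTorusGeo L k M) (fun b : Tor (fine n M) × Fin (d + 1) => blockOf n M b.1))
      (BlockNorm.ofBlocks (unitTorusGeo L k M) (fun b : Tor (fine n M) × Fin (d + 1) => blockOf n M b.1)) T (fun y y' => C * Real.exp (-(δ * tdistT M y y')))) :
    HasMaj (BlockNorm.ofBlocks (unitTorusGeo L k M) (fun b : Tor (fine n M) × Fin (d + 1) => blockOf n M b.1))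
      (BlockNorm.ofBlocks (unitTorusGeo L k M) (fun b : Tor (fine n M) × Fin (d + 1) => blockOf n M b.1)) (T ∘ₗ mulOp (chiInt M n c S))
      (fun y y' => ind (cubeBlocks M c S : Set (Tor M)) y' * (C * Real.exp (-(δ * tdistT M y y')))) := by
  classical
  intro y' μ hμ y
  dsimp only
  set blk := fun b : Tor (fine n M) × Fin (d + 1) => blockOf n M b.1 with hblk
  have hμ' : (BlockNorm.ofBlocks (unitTorusGeo L k M) blk).IsLoc y' (mulOp (chiInt M n c S) μ) := by
    intro b hb; show chiInt M n c S b * μ b = 0; rw [hμ b hb, mul_zero]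
  by_cases hy' : y' ∈ cubeBlocks M c S
  · have hi : ind (cubeBlocks M c S : Set (Tor M)) y' = 1 := by simp [ind, hy']
    rw [hi, one_mul, LinearMap.comp_apply]
    refine (hT y' _ hμ' y).trans (mul_le_mul_of_nonneg_left ?_ (mul_nonneg hC (Real.exp_nonneg _)))
    refine loc_ofBlocks_le (g := unitTorusGeo L k M) blk _ ((BlockNorm.ofBlocks (unitTorusGeo L k M) blk).loc_nonneg y' μ) fun b hb => ?_
    rw [mulOp_apply, abs_mul]
    exact (mul_le_of_le_one_left (abs_nonneg _) (abs_chiInt_le_one b)).trans (abs_le_loc_ofBlocks (g := unitTorusGeo L k M) blk μ hb)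
  · have hzero : mulOp (chiInt M n c S) μ = 0 := by
      funext b
      rw [mulOp_apply, Pi.zero_apply]
      by_cases hb : blk b = y'
      · have : b ∉ intBonds M n c S := fun h => hy' (hb ▸ blockOf_mem_cubeBlocks h)
        rw [chiInt_of_not_intBond this, zero_mul]
      · rw [hμ b hb, mul_zero]
    rw [LinearMap.comp_apply, hzero, map_zero, (BlockNorm.ofBlocks (unitTorusGeo L k M) blk).loc_zero]
    exact mul_nonneg (mul_nonneg (ind_nonneg _ _) (mul_nonneg hC (Real.exp_nonneg _))) ((BlockNorm.ofBlocks (unitTorusGeo L k M) blk).loc_nonneg y' μ)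

/-- ★★ A MULTI-REFLECTION AFTER A SOURCE-LOCALIZED OPERATOR, OBSERVED THROUGH `χ_□`: localized on both sides, cost `e^{δ}` (the bond twist may move an image into a neighbouring
block) — because mirror images of the cube's blocks are farther (`tdistT_blockOf_imgBond_ge`). [cite: Balaban1984PropagatorsII, (2.37) p.229 (method of images)] -/
theorem hasMaj_chiCube_reflSet_comp {F₁ : Type} [AddCommGroup F₁] [Module ℝ F₁] {b₁ : BlockNorm (unitTorusGeo L k M) F₁}
    {T : F₁ →ₗ[ℝ] (Tor (fine n M) × Fin (d + 1) → ℝ)} {C δ : ℝ} (hC : 0 ≤ C) (hδ : 0 ≤ δ) (hM : ∀ ν, M ν = 2 * S) (Ts : Finset (Fin (d + 1)))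
    (hT : HasMaj b₁ (BlockNorm.ofBlocks (unitTorusGeo L k M) (fun b : Tor (fine n M) × Fin (d + 1) => blockOf n M b.1)) T
      (fun y y' => ind (cubeBlocks M c S : Set (Tor M)) y' * (C * Real.exp (-(δ * tdistT M y y'))))) :
    HasMaj b₁ (BlockNorm.ofBlocks (unitTorusGeo L k M) (fun b : Tor (fine n M) × Fin (d + 1) => blockOf n M b.1))
      (mulOp (chiCube M n c S) ∘ₗ reflSet M n c Ts ∘ₗ T)
      (fun y y' => ind (cubeBlocks M c S : Set (Tor M)) y * ind (cubeBlocks M c S : Set (Tor M)) y' * (C * Real.exp δ * Real.exp (-(δ * tdistT M y y')))) := by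
  classical
  intro y' μ hμ y
  dsimp only
  set blk := fun b : Tor (fine n M) × Fin (d + 1) => blockOf n M b.1 with hblk
  have hRHS : 0 ≤ ind (cubeBlocks M c S : Set (Tor M)) y * ind (cubeBlocks M c S : Set (Tor M)) y' * (C * Real.exp δ * Real.exp (-(δ * tdistT M y y'))) * b₁.loc y' μ :=
    mul_nonneg (mul_nonneg (mul_nonneg (ind_nonneg _ _) (ind_nonneg _ _)) (mul_nonneg (mul_nonneg hC (Real.exp_nonneg _)) (Real.exp_nonneg _))) (b₁.loc_nonneg y' μ)
  refine loc_ofBlocks_le (g := unitTorusGeo L k M) blk _ hRHS fun b hb => ?_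
  rw [LinearMap.comp_apply, LinearMap.comp_apply, mulOp_apply, reflSet_apply]
  by_cases hy : blockOf n M b.1 ∈ cubeBlocks M c S
  · have hyy : y ∈ cubeBlocks M c S := hb ▸ hy
    have hiy : ind (cubeBlocks M c S : Set (Tor M)) y = 1 := by simp [ind, hyy]
    rw [hiy, one_mul]
    have h1 : |chiCube M n c S b * (sgnT M n Ts b * T μ (imgBond M n c Ts b))| ≤ |T μ (imgBond M n c Ts b)| := by
      rw [abs_mul, abs_mul]
      have hs : |sgnT M n Ts b| = 1 := by unfold sgnT; split_ifs <;> simp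
      rw [hs, one_mul]
      exact mul_le_of_le_one_left (abs_nonneg _) (abs_chiCube_le_one S b)
    refine h1.trans ((abs_le_loc_ofBlocks (g := unitTorusGeo L k M) blk (T μ) rfl).trans ((hT y' μ hμ (blk (imgBond M n c Ts b))).trans ?_))
    by_cases hy' : y' ∈ cubeBlocks M c S
    · have hi' : ind (cubeBlocks M c S : Set (Tor M)) y' = 1 := by simp [ind, hy']
      dsimp only
      rw [hi', one_mul, one_mul]
      refine mul_le_mul_of_nonneg_right ?_ (b₁.loc_nonneg y' μ)
      rw [mul_assoc]
      refine mul_le_mul_of_nonneg_left ?_ hC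
      rw [← Real.exp_add]
      refine Real.exp_le_exp.mpr ?_
      have hge := tdistT_blockOf_imgBond_ge (n := n) hM Ts hy hy'
      have hb' : blockOf n M b.1 = y := hb
      rw [hb'] at hge
      nlinarith
    · have hi' : ind (cubeBlocks M c S : Set (Tor M)) y' = 0 := by simp [ind, hy']
      dsimp only
      simp [hi']
  · rw [chiCube_of_not_mem hy, zero_mul, abs_zero]
    exact hRHS

omit [∀ μ, NeZero (M μ)] [NeZero n] in
/-- `χ_□ ∘ Sym ∘ T` is the sum of the `2^{d+1}` reflected pieces. [folklore] -/
theorem mulOp_comp_symOp_comp {F₁ : Type} [AddCommGroup F₁] [Module ℝ F₁] (T : F₁ →ₗ[ℝ] (Tor (fine n M) × Fin (d + 1) → ℝ)) (χ : Tor (fine n M) × Fin (d + 1) → ℝ) :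
    mulOp χ ∘ₗ symOp M n c ∘ₗ T = ∑ Ts ∈ (Finset.univ : Finset (Fin (d + 1))).powerset, mulOp χ ∘ₗ reflSet M n c Ts ∘ₗ T := by
  refine LinearMap.ext fun f => ?_
  simp only [symOp, LinearMap.comp_apply, LinearMap.sum_apply, map_sum]

/-- ★★ THE SYMMETRISED OPERATOR THROUGH `χ_□`: constant `2^{d+1}·C·e^{δ}`. [folklore] -/
theorem hasMaj_chiCube_symOp_comp {F₁ : Type} [AddCommGroup F₁] [Module ℝ F₁] {b₁ : BlockNorm (unitTorusGeo L k M) F₁}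
    {T : F₁ →ₗ[ℝ] (Tor (fine n M) × Fin (d + 1) → ℝ)} {C δ : ℝ} (hC : 0 ≤ C) (hδ : 0 ≤ δ) (hM : ∀ ν, M ν = 2 * S)
    (hT : HasMaj b₁ (BlockNorm.ofBlocks (unitTorusGeo L k M) (fun b : Tor (fine n M) × Fin (d + 1) => blockOf n M b.1)) T
      (fun y y' => ind (cubeBlocks M c S : Set (Tor M)) y' * (C * Real.exp (-(δ * tdistT M y y'))))) :
    HasMaj b₁ (BlockNorm.ofBlocks (unitTorusGeo L k M) (fun b : Tor (fine n M) × Fin (d + 1) => blockOf n M b.1))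
      (mulOp (chiCube M n c S) ∘ₗ symOp M n c ∘ₗ T)
      (fun y y' => ind (cubeBlocks M c S : Set (Tor M)) y * ind (cubeBlocks M c S : Set (Tor M)) y' *
        (2 ^ (d + 1) * (C * Real.exp δ) * Real.exp (-(δ * tdistT M y y')))) := by
  rw [mulOp_comp_symOp_comp]
  refine (hasMaj_finsum _ _ _ fun Ts _ => hasMaj_chiCube_reflSet_comp hC hδ hM Ts hT).mono fun y y' => le_of_eq ?_
  rw [Finset.sum_const, Finset.card_powerset, Finset.card_univ, Fintype.card_fin, nsmul_eq_mul]
  push_cast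
  ring

variable [NeZero L]

/-- ★★★ **THE GLUING LETTER OF THE NEUMANN CUBE PROPAGATOR AT `U ≡ 1`** (dag-n15-c FILE 45 `hasMaj_parametrix`'s `hG` shape, with `G_i := χ_□ ∘ G(□ + c)`): for odd `L > 1` and `a > 0`
there are `δ, β > 0` such that for EVERY torus of the lineage's family (`M_ν = 2L^m`, `n = L^K`, `K ≥ 1`) and EVERY block-aligned cube `□ + c` of side `L^m` (the half torus),
`χ_□ ∘ G(□ + c)` has the block majorant `1_□(y)·1_□(y′)·β·e^{−δ|y − y′|_T}` — the (2.133)-shaped letter, inherited from [B5] Prop. 1.2 (1.110) for the torus propagator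
(`hasMaj_gOp`) by the method of images (`β = 2^{d+1}·C·e^{δ₀}`). [cite: Balaban1984PropagatorsII, (2.133) p.247 (shape), (2.37) p.229 (Neumann cubes); Balaban1984PropagatorsI, Prop. 1.2 (1.110) p.35] -/
theorem hasMaj_chiCube_neumannCubeG (hL : Odd L ∧ 1 < L) {a : ℝ} (ha : 0 < a) :
    ∃ δ β : ℝ, 0 < δ ∧ 0 < β ∧ ∀ (m K : ℕ) (hK : 1 ≤ K) (c : Tor (MP (paramsOf d L m K hL))),
      HasMaj (BlockNorm.ofBlocks (unitTorusGeo L K (MP (paramsOf d L m K hL))) (blkFine L K (MP (paramsOf d L m K hL))))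
        (BlockNorm.ofBlocks (unitTorusGeo L K (MP (paramsOf d L m K hL))) (blkFine L K (MP (paramsOf d L m K hL))))
        (mulOp (chiCube (MP (paramsOf d L m K hL)) (L ^ K) c (L ^ m)) ∘ₗ neumannCubeG (MP (paramsOf d L m K hL)) (L ^ K) c (L ^ m) a)
        (fun y y' => ind ((cubeBlocks (MP (paramsOf d L m K hL)) c (L ^ m) : Finset _) : Set _) y *
          ind ((cubeBlocks (MP (paramsOf d L m K hL)) c (L ^ m) : Finset _) : Set _) y' *
          (β * Real.exp (-(δ * tdistT (MP (paramsOf d L m K hL)) y y')))) := by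
  obtain ⟨δ₀, C, hδ₀, hC, H⟩ := hasMaj_gOp (d := d) hL ha
  refine ⟨δ₀, 2 ^ (d + 1) * (C * Real.exp δ₀), hδ₀, by positivity, fun m K hK c => ?_⟩
  have hM : ∀ ν, MP (paramsOf d L m K hL) ν = 2 * L ^ m := fun ν => rfl
  have hG := H m K hK
  have h1 := hasMaj_comp_mulOp_chiInt (c := c) (S := L ^ m) hC.le hG
  exact hasMaj_chiCube_symOp_comp hC.le hδ₀.le hM h1

end Majorant

end Summit.QuantumFields.YangMills.BalabanUVNodes.N15.TwoGrid
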